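import Mathlib
import Summits.Ventures.PercRepro2.Defs
import Summits.Ventures.PercRepro2.Graph
import Summits.Ventures.PercRepro2.OneColourSwitch
import Summits.Ventures.PercRepro2.RegionHubSign
import Summits.Ventures.PercRepro2.SideSwitch
import Summits.Ventures.PercRepro2.M9NoPocketDefs
import Summits.Ventures.PercRepro2.M9DAvoid
import Summits.Ventures.PercRepro2.M9DAvoidSplit

/-!
# The three regions of the `d`-avoiding sum (blind cell PercRepro2, p3 g23, 2026-08-28;
`proofs/P3-HARRIS.md` §2)

The `d`-avoiding sum `T1 = dSignSumAvoid = Σ_{Sep ∧ DOne} σ̃_pq · σ_rs` of the single-`d` family is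
split, at the level of colourings, by whether `d` has a **hub edge**: `hubY ω` says some `Y`-edge
at `d` ends at a vertex `Y`-connected in `G − d` to `p` or `q`, `hubW` is the `W`-mirror.  Under
`Sep`, a `Y`-hub edge puts `d` outside the `Y`-world of `{r, s}` (`not_mem_K2_of_hubY`), so
when `d` is joined to `r` and to `s` every `T`-edge is `W`, `r ~_W s` through `d`, and
`σ_rs = −1[r ≁_Y s]` (`sigma_rs_of_hubY`); the two hub kinds exclude each other under `Sep`
(`not_hubY_and_hubW`).  Hence

  `dSignSumAvoid = regionL − regionY + regionW = regionL − 2 · regionY`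

(`dSignSumAvoid_eq_regions`, `dSignSumAvoid_eq_regionL_sub`), with `regionL` the sum over the
hub-free colourings (every `T`-colouring of which is `Sep`), `regionY = Σ_{Sep ∧ DOne ∧ hubY ∧ r ≁_Y s} σ̃_pq`
and `regionW` its mirror (`regionW_eq_neg_regionY`, by the colour flip).  The class theorem of
P3-HARRIS is then `regionY ≥ 0` (Harris on the block-group cube) and `regionL ≤ 0` (Harris on the
projection classes).  Own work; std axioms.
-/

namespace Summit.Ventures.PercRepro2

namespace NoPocket

open Finset Classical RegionHub OneColourSwitch SideSwitch

variable {V : Type*} {E : Type*}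

section Hub

variable (ends : E → Sym2 V)

/-- `d` has a `Y`-hub edge: a `Y`-edge `d–u` whose other end is `Y`-connected in `G − d` to `p`
or to `q`. -/
def hubY (d p q : V) (ω : Config E) : Prop :=
  ∃ e u, ends e = s(d, u) ∧ ω e = true ∧
    (Conn (endsD ends d) ω u p ∨ Conn (endsD ends d) ω u q)

/-- `d` has a `W`-hub edge (the mirror of `hubY`). -/
def hubW (d p q : V) (ω : Config E) : Prop := hubY ends d p q (OneColourSwitch.compl ω)

variable {ends}

/-- The `W`-hub of the flipped colouring is the `Y`-hub. -/
lemma hubW_compl {d p q : V} (ω : Config E) :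
    hubW ends d p q (OneColourSwitch.compl ω) ↔ hubY ends d p q ω := by
  simp only [hubW, compl_compl]

/-- A `Y`-hub edge joins `d` to `p` or to `q` in `G`. -/
lemma conn_d_of_hubY {d p q : V} {ω : Config E} (h : hubY ends d p q ω) :
    Conn ends ω d p ∨ Conn ends ω d q := by
  obtain ⟨e, u, hends, he, hc⟩ := h
  have hdu : Conn ends ω d u := conn_of_openAdj ⟨e, he, hends⟩
  rcases hc with hc | hc
  · exact Or.inl (conn_trans hdu (conn_of_conn_endsD hc))
  · exact Or.inr (conn_trans hdu (conn_of_conn_endsD hc))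

/-- Under `Sep`, a `Y`-hub edge keeps `d` out of the `Y`-world of `{r, s}`. -/
lemma not_mem_K2_of_hubY {d p q r s : V} {ω : Config E} (hsep : sep2 ends p q r s ω)
    (h : hubY ends d p q ω) : d ∉ K2 ends r s ω := by
  intro hd
  obtain ⟨hp, hq⟩ := not_mem_K2_of_sep2 hsep
  rcases conn_d_of_hubY h with hc | hc
  · apply hp
    rcases mem_K2_iff.1 hd with h' | h'
    · exact mem_K2_iff.2 (Or.inl (conn_trans h' hc))
    · exact mem_K2_iff.2 (Or.inr (conn_trans h' hc))
  · apply hq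
    rcases mem_K2_iff.1 hd with h' | h'
    · exact mem_K2_iff.2 (Or.inl (conn_trans h' hc))
    · exact mem_K2_iff.2 (Or.inr (conn_trans h' hc))

/-- Under `Sep`, a `W`-hub edge keeps `d` out of the `W`-world of `{r, s}`. -/
lemma not_mem_M2_of_hubW {d p q r s : V} {ω : Config E} (hsep : sep2 ends p q r s ω)
    (h : hubW ends d p q ω) : d ∉ M2 ends r s ω :=
  not_mem_K2_of_hubY (ω := OneColourSwitch.compl ω) (sep2_compl.2 hsep) h

/-- With an edge from `d` to `r`, `d ∉ K₂` forces that edge to be `W`, so `r ~_W d`. -/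
lemma conn_compl_of_edge_of_not_mem_K2 {d r s t : V} {ω : Config E} (hd : d ∉ K2 ends r s ω)
    (ht : t = r ∨ t = s) {e : E} (he : ends e = s(d, t)) :
    Conn ends (OneColourSwitch.compl ω) d t := by
  have hd' : d ∉ M2 ends r s (OneColourSwitch.compl ω) := by rwa [M2_compl]
  simpa using conn_of_edge_of_not_mem_M2 (ω := OneColourSwitch.compl ω) hd' ht he

/-- **`σ_rs` on the `Y`-hub region**: under `Sep`, with edges `d–r` and `d–s`, a `Y`-hub edge
forces both `T`-edges `W`, hence `r ~_W s`, and `σ_rs = 1[r ~_Y s] − 1`. -/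
lemma sigma_rs_of_hubY {d p q r s : V} {ω : Config E} (hsep : sep2 ends p q r s ω)
    (h : hubY ends d p q ω) {er es : E} (hr : ends er = s(d, r)) (hs : ends es = s(d, s)) :
    sigma ends ω r s = (if Conn ends ω r s then 1 else 0) - 1 := by
  have hd := not_mem_K2_of_hubY hsep h
  have h1 := conn_compl_of_edge_of_not_mem_K2 hd (Or.inl rfl) hr
  have h2 := conn_compl_of_edge_of_not_mem_K2 hd (Or.inr rfl) hs
  have hrs : Conn ends (OneColourSwitch.compl ω) r s := conn_trans (conn_symm h1) h2
  simp only [sigma, hrs, if_true]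

/-- **`σ_rs` on the `W`-hub region**: the mirror, `σ_rs = 1 − 1[r ~_W s]`. -/
lemma sigma_rs_of_hubW {d p q r s : V} {ω : Config E} (hsep : sep2 ends p q r s ω)
    (h : hubW ends d p q ω) {er es : E} (hr : ends er = s(d, r)) (hs : ends es = s(d, s)) :
    sigma ends ω r s = 1 - (if Conn ends (OneColourSwitch.compl ω) r s then 1 else 0) := by
  have := sigma_rs_of_hubY (ω := OneColourSwitch.compl ω) (sep2_compl.2 hsep) h hr hs
  rw [sigma_compl'] at this
  linarith

/-- Under `Sep`, with an edge `d–r`, `d` cannot have hub edges of both colours. -/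
lemma not_hubY_and_hubW {d p q r s : V} {ω : Config E} (hsep : sep2 ends p q r s ω)
    {er : E} (hr : ends er = s(d, r)) : ¬ (hubY ends d p q ω ∧ hubW ends d p q ω) := by
  rintro ⟨hY, hW⟩
  have hd := not_mem_K2_of_hubY hsep hY
  have hM := not_mem_M2_of_hubW hsep hW
  apply hM
  have := conn_compl_of_edge_of_not_mem_K2 hd (Or.inl rfl) hr
  exact mem_M2_iff.2 (Or.inl (conn_symm this))

end Hub

section Regions

variable [Fintype E] [DecidableEq E]
variable (ends : E → Sym2 V)

/-- The hub-free region: `Σ_{Sep ∧ DOne ∧ ¬hubY ∧ ¬hubW} σ̃_pq · σ_rs`. -/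
noncomputable def regionL (p q r s d : V) : ℤ :=
  ∑ ω : Config E, if sep2 ends p q r s ω ∧ DOne ends r s d ω ∧
      ¬ hubY ends d p q ω ∧ ¬ hubW ends d p q ω then
    sigma (endsD ends d) ω p q * sigma ends ω r s else 0

/-- The `Y`-hub region: `Σ_{Sep ∧ DOne ∧ hubY ∧ r ≁_Y s} σ̃_pq`. -/
noncomputable def regionY (p q r s d : V) : ℤ :=
  ∑ ω : Config E, if sep2 ends p q r s ω ∧ DOne ends r s d ω ∧ hubY ends d p q ω ∧
      ¬ Conn ends ω r s then
    sigma (endsD ends d) ω p q else 0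

/-- The `W`-hub region: `Σ_{Sep ∧ DOne ∧ hubW ∧ r ≁_W s} σ̃_pq`. -/
noncomputable def regionW (p q r s d : V) : ℤ :=
  ∑ ω : Config E, if sep2 ends p q r s ω ∧ DOne ends r s d ω ∧ hubW ends d p q ω ∧
      ¬ Conn ends (OneColourSwitch.compl ω) r s then
    sigma (endsD ends d) ω p q else 0

variable {ends}

/-- **The three-region identity**: with edges `d–r` and `d–s`,
`dSignSumAvoid = regionL − regionY + regionW`. -/
theorem dSignSumAvoid_eq_regions (p q r s d : V) {er es : E} (hr : ends er = s(d, r))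
    (hs : ends es = s(d, s)) :
    dSignSumAvoid ends p q r s d =
      regionL ends p q r s d - regionY ends p q r s d + regionW ends p q r s d := by
  unfold dSignSumAvoid regionL regionY regionW
  rw [← Finset.sum_sub_distrib, ← Finset.sum_add_distrib]
  refine Finset.sum_congr rfl fun ω _ => ?_
  by_cases hsd : sep2 ends p q r s ω ∧ DOne ends r s d ω
  · obtain ⟨hsep, hD⟩ := hsd
    have hex := not_hubY_and_hubW (p := p) (q := q) (s := s) hsep hr
    by_cases hY : hubY ends d p q ω
    · have hW : ¬ hubW ends d p q ω := fun hW => hex ⟨hY, hW⟩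
      have hσ := sigma_rs_of_hubY hsep hY hr hs
      simp only [hsep, hD, hY, hW, true_and, and_true, not_true_eq_false, false_and, and_false,
        if_false, if_true, hσ]
      by_cases hc : Conn ends ω r s <;> simp [hc]
    · by_cases hW : hubW ends d p q ω
      · have hσ := sigma_rs_of_hubW hsep hW hr hs
        simp only [hsep, hD, hY, hW, true_and, and_true, not_true_eq_false, false_and, and_false,
          if_false, if_true, not_false_eq_true, hσ]
        by_cases hc : Conn ends (OneColourSwitch.compl ω) r s <;> simp [hc]
      · simp [hsep, hD, hY, hW]
  · simp only [hsd, if_false]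
    have h1 : ¬ (sep2 ends p q r s ω ∧ DOne ends r s d ω ∧ ¬ hubY ends d p q ω ∧
        ¬ hubW ends d p q ω) := fun h => hsd ⟨h.1, h.2.1⟩
    have h2 : ¬ (sep2 ends p q r s ω ∧ DOne ends r s d ω ∧ hubY ends d p q ω ∧
        ¬ Conn ends ω r s) := fun h => hsd ⟨h.1, h.2.1⟩
    have h3 : ¬ (sep2 ends p q r s ω ∧ DOne ends r s d ω ∧ hubW ends d p q ω ∧
        ¬ Conn ends (OneColourSwitch.compl ω) r s) := fun h => hsd ⟨h.1, h.2.1⟩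
    simp only [h1, h2, h3, if_false, sub_zero, add_zero]

/-- **The `W`-hub region is the opposite of the `Y`-hub region** (colour flip). -/
theorem regionW_eq_neg_regionY (p q r s d : V) :
    regionW ends p q r s d = - regionY ends p q r s d := by
  unfold regionW regionY
  rw [← Finset.sum_neg_distrib]
  rw [← sum_compl' (fun ω => if sep2 ends p q r s ω ∧ DOne ends r s d ω ∧ hubW ends d p q ω ∧
      ¬ Conn ends (OneColourSwitch.compl ω) r s then sigma (endsD ends d) ω p q else 0)]
  refine Finset.sum_congr rfl fun ω _ => ?_
  simp only [sep2_compl, DOne_compl_iff, hubW_compl, compl_compl, sigma_compl']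
  split_ifs <;> ring

/-- **`T1 = regionL − 2 · regionY`** with edges `d–r` and `d–s`. -/
theorem dSignSumAvoid_eq_regionL_sub (p q r s d : V) {er es : E} (hr : ends er = s(d, r))
    (hs : ends es = s(d, s)) :
    dSignSumAvoid ends p q r s d = regionL ends p q r s d - 2 * regionY ends p q r s d := by
  rw [dSignSumAvoid_eq_regions p q r s d hr hs, regionW_eq_neg_regionY]
  ring

/-- **The reduction of the class theorem**: `regionY ≥ 0` and `regionL ≤ 0` give
`dSignSumAvoid ≤ 0`. -/
theorem dSignSumAvoid_nonpos_of_regions (p q r s d : V) {er es : E} (hr : ends er = s(d, r))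
    (hs : ends es = s(d, s)) (hY : 0 ≤ regionY ends p q r s d)
    (hL : regionL ends p q r s d ≤ 0) : dSignSumAvoid ends p q r s d ≤ 0 := by
  rw [dSignSumAvoid_eq_regionL_sub p q r s d hr hs]
  linarith

end Regions

end NoPocket

end Summit.Ventures.PercRepro2
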